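import Summits.Schanuel.Schanuel.Theorems.ZilberEacBranchCycleMaster
import Summits.Schanuel.Schanuel.Theorems.ZilberEacCurveGraphFibreSurface
import Summits.Schanuel.Schanuel.Theorems.ZilberEacGraphThreePointEdge
import HarnessLib

/-!
# Arbitrary base branches, VII: THE FIRST NON-RATIONAL BASE CURVE — over the genus-one curve
# `x₁² - x₀² x₁ = 1`, the surface `y₀ = x₁ - x₀² + 1` has Zariski-dense exponential points

HONEST FRAMING.  Cell `pub-schanuel` (Zilber's Exponential-Algebraic Closedness, case ladder;
host summit Schanuel), seat 2, gen 28.  All base curves decided by gens 8–27 were RATIONAL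
(lines, polynomial graphs, polynomially parametrised curves).  The affine curve

  `C : x₁² - x₀² x₁ - 1 = 0`   (`x₁ = (x₀² ± √(x₀⁴ + 4))/2`; birational to `w² = x₀⁴ + 4`, GENUS 1)

is not rational.  Along its branch at infinity `x₀ = 1/s`, `x₁ = Φ(s)/s²`,
`Φ = (1 + √(1 + 4s⁴))/2` (`Φ(0) = 1`, `Φ² - Φ = s⁴`), the second coordinate grows faster
(`k = 1 < M = 2`), and the regular function `R = x₁ - x₀² + 1 = 1 + 1/x₁` tends to `θ = 1`:
`y₀ = ψ(s) = 1 + s²/Φ(s)`.  The fibre relation is `F(x₀, y₀) = y₀² + (x₀² - 2)y₀ - x₀²`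
(irreducible: discriminant `x₀⁴ + 4`, not a square), with the zero `y₀ = 0` over `x₀ = 0`.
The master theorem of file V gives **`unprojectedDense_genusOne_graphFibre`**: the surface
`S = {x₁² - x₀²x₁ = 1, y₀ = x₁ - x₀² + 1} ⊆ ℂ² × ℂ²` (irreducible of dimension `2`, file VI) has
`I(S ∩ Γ_exp) = I(S)` — its exponential points `(x₀, x₁, e^{x₀}, e^{x₁})`, i.e. the points of `C`
with `e^{x₀} = x₁ - x₀² + 1`, are Zariski dense in `S`.  A decided instance of Mantova–Masser's
question (PLMS 2024 §1 p. 5) over a non-rational base; the question stays OPEN in general;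
EC(3,2) OPEN; NOT Schanuel's conjecture (neither used nor implied); EAC ⇏ SC.
-/

noncomputable section

open Filter Topology Set Complex MvPolynomial
open Literature.NumberTheory.Transcendental Literature.ModelTheory.Zilber
open Literature.ModelTheory.ExponentialFields

set_option linter.dupNamespace false

namespace Summit.Schanuel.Schanuel.Theorems

/-! ## Part A. Algebra: `X⁴ + 4` is not a square; the two irreducible quadratics -/

/-- `X⁴ + 4 ∈ ℂ[X]` is not a square (`(r - X²)(r + X²) = 4` would make both factors constant).
[folklore] -/
theorem X_pow_four_add_four_ne_sq (r : Polynomial ℂ) :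
    (Polynomial.X ^ 4 + 4 : Polynomial ℂ) ≠ r ^ 2 := by
  intro h
  have hprod : (r - Polynomial.X ^ 2) * (r + Polynomial.X ^ 2) = Polynomial.C 4 := by
    have e : (r - Polynomial.X ^ 2) * (r + Polynomial.X ^ 2) = r ^ 2 - Polynomial.X ^ 4 := by ring
    rw [e, ← h]
    simp [map_ofNat]
  have h4 : (Polynomial.C (4 : ℂ)) ≠ 0 := by
    rw [Ne, Polynomial.C_eq_zero]; norm_num
  have hne₁ : r - Polynomial.X ^ 2 ≠ 0 := by
    intro h0; rw [h0, zero_mul] at hprod; exact h4 hprod.symm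
  have hne₂ : r + Polynomial.X ^ 2 ≠ 0 := by
    intro h0; rw [h0, mul_zero] at hprod; exact h4 hprod.symm
  have hdeg := congrArg Polynomial.natDegree hprod
  rw [Polynomial.natDegree_mul hne₁ hne₂, Polynomial.natDegree_C] at hdeg
  have hd₁ : (r - Polynomial.X ^ 2).natDegree = 0 := by omega
  have hd₂ : (r + Polynomial.X ^ 2).natDegree = 0 := by omega
  obtain ⟨a, ha⟩ := Polynomial.natDegree_eq_zero.1 hd₁
  obtain ⟨b, hb⟩ := Polynomial.natDegree_eq_zero.1 hd₂
  have hX2 : (2 : Polynomial ℂ) * Polynomial.X ^ 2 = Polynomial.C (b - a) := by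
    rw [map_sub, hb, ha]; ring
  have hdeg2 := congrArg Polynomial.natDegree hX2
  rw [Polynomial.natDegree_C, show (2 : Polynomial ℂ) = Polynomial.C 2 by simp [map_ofNat],
    Polynomial.natDegree_C_mul_X_pow 2 (2 : ℂ) two_ne_zero] at hdeg2
  exact two_ne_zero hdeg2

/-- The base relation `t² - s² t - 1` (the curve `x₁² - x₀²x₁ = 1`, `s = x₀`, `t = x₁`) is
irreducible in `ℂ[s][t]`: discriminant `s⁴ + 4`. [folklore] -/
theorem irreducible_genusOne_baseRow :
    Irreducible (Polynomial.C (1 : Polynomial ℂ) * Polynomial.X ^ 2 +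
      Polynomial.C (-(Polynomial.X ^ 2) : Polynomial ℂ) * Polynomial.X +
      Polynomial.C (-1 : Polynomial ℂ)) := by
  refine irreducible_quadratic_of_disc_ne_sq one_ne_zero isCoprime_one_left fun r => ?_
  have e : (-(Polynomial.X ^ 2) : Polynomial ℂ) ^ 2 - 4 * 1 * (-1) = Polynomial.X ^ 4 + 4 := by ring
  rw [e]
  exact X_pow_four_add_four_ne_sq r

/-- The fibre relation `t² + (s² - 2) t - s²` (`s = x₀`, `t = y₀`; the image of the surface in the
`(x₀, y₀)`-plane) is irreducible in `ℂ[s][t]`: discriminant `s⁴ + 4`. [folklore] -/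
theorem irreducible_genusOne_fibreRow :
    Irreducible (Polynomial.C (1 : Polynomial ℂ) * Polynomial.X ^ 2 +
      Polynomial.C (Polynomial.X ^ 2 - 2 : Polynomial ℂ) * Polynomial.X +
      Polynomial.C (-(Polynomial.X ^ 2) : Polynomial ℂ)) := by
  refine irreducible_quadratic_of_disc_ne_sq one_ne_zero isCoprime_one_left fun r => ?_
  have e : (Polynomial.X ^ 2 - 2 : Polynomial ℂ) ^ 2 - 4 * 1 * (-(Polynomial.X ^ 2)) =
      Polynomial.X ^ 4 + 4 := by ring
  rw [e]
  exact X_pow_four_add_four_ne_sq r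

/-- Evaluation of a quadratic row polynomial `t² + b(s) t + c(s)` at `(x, y)`. [folklore] -/
theorem evalPP_monicQuadratic (b c : Polynomial ℂ) (x y : ℂ) :
    ((Polynomial.C (1 : Polynomial ℂ) * Polynomial.X ^ 2 + Polynomial.C b * Polynomial.X +
        Polynomial.C c).map (Polynomial.evalRingHom x)).eval y =
      y ^ 2 + b.eval x * y + c.eval x := by
  simp

/-- The base curve as the rows `t² - s²t - 1` evaluated: `x₁² - x₀² x₁ - 1`. [folklore] -/
theorem eval_genusOne_baseMv (x y : ℂ) :
    MvPolynomial.eval ![x, y] (X 1 ^ 2 - X 0 ^ 2 * X 1 - 1 : MvPolynomial (Fin 2) ℂ) =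
      ((Polynomial.C (1 : Polynomial ℂ) * Polynomial.X ^ 2 +
        Polynomial.C (-(Polynomial.X ^ 2) : Polynomial ℂ) * Polynomial.X +
        Polynomial.C (-1 : Polynomial ℂ)).map (Polynomial.evalRingHom x)).eval y := by
  rw [evalPP_monicQuadratic]
  simp
  ring

/-- The base curve `x₁² - x₀² x₁ - 1` is irreducible in `ℂ[x₀, x₁]`. [folklore] -/
theorem irreducible_genusOne_baseMv :
    Irreducible (X 1 ^ 2 - X 0 ^ 2 * X 1 - 1 : MvPolynomial (Fin 2) ℂ) :=
  (irreducible_rows_iff eval_genusOne_baseMv).2 irreducible_genusOne_baseRow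

/-! ## Part B. The branch at infinity `x₀ = 1/s`, `x₁ = Φ(s)/s²`, `y₀ = 1 + s²/Φ(s)` -/

/-- The analytic data of the branch: `Φ = (1 + √(1 + 4s⁴))/2` (principal square root) is analytic
at `0`, `Φ(0) = 1`, and near `0`: `Φ(s) ≠ 0` and `Φ(s)² - Φ(s) = s⁴`. [folklore] -/
theorem genusOne_branch_facts :
    ∃ Φ : ℂ → ℂ, AnalyticAt ℂ Φ 0 ∧ Φ 0 = 1 ∧
      ∀ᶠ s in 𝓝 (0 : ℂ), Φ s ≠ 0 ∧ Φ s ^ 2 - Φ s = s ^ 4 := by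
  set u : ℂ → ℂ := fun s => 1 + 4 * s ^ 4 with hu
  have huan : AnalyticAt ℂ u 0 := analyticAt_const.add (analyticAt_const.mul (analyticAt_id.pow 4))
  have hu0 : u 0 = 1 := by simp [hu]
  have hsmall : ∀ᶠ s in 𝓝 (0 : ℂ), ‖(4 : ℂ) * s ^ 4‖ < 1 := by
    have hc : ContinuousAt (fun s : ℂ => (4 : ℂ) * s ^ 4) 0 :=
      continuousAt_const.mul (continuousAt_id.pow 4)
    have h := hc.tendsto
    simp only [ne_eq, OfNat.ofNat_ne_zero, not_false_eq_true, zero_pow, mul_zero] at h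
    have := (Metric.tendsto_nhds.1 h) 1 one_pos
    filter_upwards [this] with s hs
    rwa [dist_zero_right] at hs
  set Φ : ℂ → ℂ := fun s => (1 + Complex.exp ((1 / 2 : ℂ) * Complex.log (1 + 4 * s ^ 4))) / 2
    with hΦ
  have h1 : AnalyticAt ℂ (fun s : ℂ => Complex.exp ((1 / 2 : ℂ) * Complex.log (u s))) 0 :=
    (analyticAt_const.mul (huan.clog (by rw [hu0]; exact Complex.one_mem_slitPlane))).cexp
  have hΦan : AnalyticAt ℂ Φ 0 := (analyticAt_const.add h1).div_const
  have hΦ0 : Φ 0 = 1 := by norm_num [hΦ]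
  refine ⟨Φ, hΦan, hΦ0, ?_⟩
  have hΦne : ∀ᶠ s in 𝓝 (0 : ℂ), Φ s ≠ 0 :=
    hΦan.continuousAt.eventually_ne (by rw [hΦ0]; exact one_ne_zero)
  filter_upwards [hΦne, hsmall] with s hne hs
  refine ⟨hne, ?_⟩
  have hslit : 1 + 4 * s ^ 4 ∈ Complex.slitPlane := Complex.mem_slitPlane_of_norm_lt_one hs
  have hne0 : 1 + 4 * s ^ 4 ≠ 0 := Complex.slitPlane_ne_zero hslit
  have hsq : Complex.exp ((1 / 2 : ℂ) * Complex.log (1 + 4 * s ^ 4)) ^ 2 = 1 + 4 * s ^ 4 := by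
    rw [← Complex.exp_nat_mul, ← mul_assoc, show ((2 : ℕ) : ℂ) * (1 / 2 : ℂ) = 1 by norm_num,
      one_mul]
    exact Complex.exp_log hne0
  rw [hΦ]
  linear_combination (1 / 4 : ℂ) * hsq

/-! ## Part C. The density theorem -/

/-- **Over the genus-one curve `x₁² - x₀²x₁ = 1`, the surface `y₀ = x₁ - x₀² + 1` has
Zariski-dense exponential points**, `I(S ∩ Γ_exp) = I(S)`.  See the module docstring.
[cite: MantovaMasser2023, §1 Further remarks, p. 5 (the question, open in general)] (new) -/
theorem unprojectedDense_genusOne_graphFibre :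
    UnprojectedDense {w : Fin 2 ⊕ Fin 2 → ℂ |
      MvPolynomial.eval ![w (Sum.inl 0), w (Sum.inl 1)]
        (X 1 ^ 2 - X 0 ^ 2 * X 1 - 1 : MvPolynomial (Fin 2) ℂ) = 0 ∧
      w (Sum.inr 0) = MvPolynomial.eval ![w (Sum.inl 0), w (Sum.inl 1)]
        (X 1 - X 0 ^ 2 + 1 : MvPolynomial (Fin 2) ℂ)} := by
  -- the surface
  have hS := isIrreducibleClosed_curveGraphFibre (X 1 - X 0 ^ 2 + 1 : MvPolynomial (Fin 2) ℂ)
    irreducible_genusOne_baseMv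
  have hdim := zariskiDim_curveGraphFibre (X 1 - X 0 ^ 2 + 1 : MvPolynomial (Fin 2) ℂ)
    irreducible_genusOne_baseMv
  -- the two relations
  set Arow : Polynomial (Polynomial ℂ) := Polynomial.C (1 : Polynomial ℂ) * Polynomial.X ^ 2 +
      Polynomial.C (-(Polynomial.X ^ 2) : Polynomial ℂ) * Polynomial.X +
      Polynomial.C (-1 : Polynomial ℂ) with hArow
  set Frow : Polynomial (Polynomial ℂ) := Polynomial.C (1 : Polynomial ℂ) * Polynomial.X ^ 2 +
      Polynomial.C (Polynomial.X ^ 2 - 2 : Polynomial ℂ) * Polynomial.X +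
      Polynomial.C (-(Polynomial.X ^ 2) : Polynomial ℂ) with hFrow
  have hAirr : Irreducible Arow := irreducible_genusOne_baseRow
  have hFirr : Irreducible Frow := irreducible_genusOne_fibreRow
  have hAdeg : Arow.natDegree = 2 := by
    rw [hArow]; exact Polynomial.natDegree_quadratic one_ne_zero
  have hFdeg : Frow.natDegree = 2 := by
    rw [hFrow]; exact Polynomial.natDegree_quadratic one_ne_zero
  have hA1 : Arow.natDegree ≠ 0 := by rw [hAdeg]; norm_num
  have hF1 : Frow.natDegree ≠ 0 := by rw [hFdeg]; norm_num
  have hFcoeff0 : Frow.coeff 0 = -(Polynomial.X ^ 2) := by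
    rw [hFrow, Polynomial.coeff_add, Polynomial.coeff_add, Polynomial.coeff_C_mul_X_pow,
      Polynomial.coeff_C_mul_X, Polynomial.coeff_C_zero]
    simp
  have hF00 : Frow.coeff 0 ≠ 0 := by
    rw [hFcoeff0, neg_ne_zero]; exact pow_ne_zero _ Polynomial.X_ne_zero
  have ha : (Frow.coeff 0).IsRoot 0 := by rw [hFcoeff0]; simp
  have hAeval : ∀ x y : ℂ, (Arow.map (Polynomial.evalRingHom x)).eval y = y ^ 2 - x ^ 2 * y - 1 := by
    intro x y; rw [hArow, evalPP_monicQuadratic]; simp; ring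
  have hFeval : ∀ x y : ℂ, (Frow.map (Polynomial.evalRingHom x)).eval y =
      y ^ 2 + (x ^ 2 - 2) * y - x ^ 2 := by
    intro x y; rw [hFrow, evalPP_monicQuadratic]; simp; ring
  -- the branch
  obtain ⟨Φ, hΦan, hΦ0, hΦfacts⟩ := genusOne_branch_facts
  set ψ : ℂ → ℂ := fun s => 1 + s ^ 2 / Φ s with hψ
  have hΦ0' : Φ 0 ≠ 0 := by rw [hΦ0]; exact one_ne_zero
  have hψan : AnalyticAt ℂ ψ 0 := analyticAt_const.add ((analyticAt_id.pow 2).div hΦan hΦ0')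
  have hψ0 : ψ 0 = 1 := by simp [hψ]
  have hfacts : ∀ᶠ s in 𝓝[≠] (0 : ℂ), s ≠ 0 ∧ Φ s ≠ 0 ∧ Φ s ^ 2 - Φ s = s ^ 4 := by
    filter_upwards [self_mem_nhdsWithin, nhdsWithin_le_nhds hΦfacts] with s hs h
    exact ⟨hs, h.1, h.2⟩
  have hbranch : ∀ᶠ s in 𝓝[≠] (0 : ℂ),
      (Frow.map (Polynomial.evalRingHom (s ^ 1)⁻¹)).eval (ψ s) = 0 := by
    filter_upwards [hfacts] with s ⟨hs, hΦs, hkey⟩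
    rw [hFeval, pow_one, hψ]
    simp only
    field_simp
    linear_combination (-(s ^ 2)) * hkey
  have hbase : ∀ᶠ s in 𝓝[≠] (0 : ℂ),
      (Arow.map (Polynomial.evalRingHom (s ^ 1)⁻¹)).eval (Φ s * (s ^ 2)⁻¹) = 0 := by
    filter_upwards [hfacts] with s ⟨hs, hΦs, hkey⟩
    rw [hAeval, pow_one]
    field_simp
    linear_combination hkey
  have hgerm : ∀ᶠ s in 𝓝[≠] (0 : ℂ),
      (Sum.elim ![(s ^ 1)⁻¹, Φ s * (s ^ 2)⁻¹] ![ψ s, Complex.exp (Φ s * (s ^ 2)⁻¹)] :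
        Fin 2 ⊕ Fin 2 → ℂ) ∈ {w : Fin 2 ⊕ Fin 2 → ℂ |
      MvPolynomial.eval ![w (Sum.inl 0), w (Sum.inl 1)]
        (X 1 ^ 2 - X 0 ^ 2 * X 1 - 1 : MvPolynomial (Fin 2) ℂ) = 0 ∧
      w (Sum.inr 0) = MvPolynomial.eval ![w (Sum.inl 0), w (Sum.inl 1)]
        (X 1 - X 0 ^ 2 + 1 : MvPolynomial (Fin 2) ℂ)} := by
    filter_upwards [hfacts, hbase] with s ⟨hs, hΦs, hkey⟩ hA
    refine ⟨?_, ?_⟩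
    · simp only [Sum.elim_inl, Matrix.cons_val_zero, Matrix.cons_val_one]
      rw [eval_genusOne_baseMv]
      exact hA
    · simp only [Sum.elim_inr, Sum.elim_inl, Matrix.cons_val_zero, Matrix.cons_val_one]
      simp only [map_add, map_sub, map_pow, map_one, MvPolynomial.eval_X, Matrix.cons_val_one,
        Matrix.cons_val_zero, pow_one, hψ]
      field_simp
      linear_combination (-1 : ℂ) * hkey
  -- the zero branch of `F` (Newton–Puiseux at the root `x₀ = 0` of `q₀ = -x₀²`)
  obtain ⟨e, η, he, hηan, hη0, hηne, hFη⟩ := exists_zeroBranch_puiseux Frow hFirr hF1 hF00 ha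
  exact unprojectedDense_branch_cycle_zeroBranch hS (le_of_eq hdim) Frow hFirr hF1 Arow hAirr hA1
    (le_refl 1) (le_refl 2) hψan one_ne_zero hψ0 hΦan hΦ0' hbranch hbase hgerm
    (analyticAt_const.add (analyticAt_id.pow e)) hηan hη0 (deriv_newtonBase_ne_zero 0 he) hηne hFη

/-- **The same surface in plain coordinates**: `{x₁² - x₀²x₁ - 1 = 0, y₀ = x₁ - x₀² + 1}` has
Zariski-dense exponential points.
[cite: MantovaMasser2023, §1 Further remarks, p. 5 (the question, open in general)] (new) -/
theorem unprojectedDense_genusOne_graphFibre' :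
    UnprojectedDense {w : Fin 2 ⊕ Fin 2 → ℂ |
      w (Sum.inl 1) ^ 2 - w (Sum.inl 0) ^ 2 * w (Sum.inl 1) - 1 = 0 ∧
      w (Sum.inr 0) = w (Sum.inl 1) - w (Sum.inl 0) ^ 2 + 1} := by
  have h := unprojectedDense_genusOne_graphFibre
  have e : {w : Fin 2 ⊕ Fin 2 → ℂ |
      MvPolynomial.eval ![w (Sum.inl 0), w (Sum.inl 1)]
        (X 1 ^ 2 - X 0 ^ 2 * X 1 - 1 : MvPolynomial (Fin 2) ℂ) = 0 ∧
      w (Sum.inr 0) = MvPolynomial.eval ![w (Sum.inl 0), w (Sum.inl 1)]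
        (X 1 - X 0 ^ 2 + 1 : MvPolynomial (Fin 2) ℂ)} =
      {w : Fin 2 ⊕ Fin 2 → ℂ | w (Sum.inl 1) ^ 2 - w (Sum.inl 0) ^ 2 * w (Sum.inl 1) - 1 = 0 ∧
        w (Sum.inr 0) = w (Sum.inl 1) - w (Sum.inl 0) ^ 2 + 1} := by
    ext w
    simp
  rw [e] at h
  exact h

end Summit.Schanuel.Schanuel.Theorems
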